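import Literature.AnabelianGeometry.EtaleTheta.Discharge.Sec2NondiscretenessProofs
import Literature.AnabelianGeometry.EtaleTheta.TowerOfSetting

/-!
# [EtTh] §2 discharge: Corollary 2.16 from the bi-theta symmetry clause for the POWERS OF ONE
# GENERATOR of `Gal(Y/X)` (sharpening of `Sec2NondiscretenessProofs.lean`)

Mochizuki, *The Étale Theta Function and its Frobenioid-theoretic Manifestations* [EtTh],
Publ. RIMS 45 (2009), §2, Cor 2.16 pp.53–54 and Prop 2.14 (iii) p.50 (locators `p.N` = PDF pages of
the PRIMS text; bib key `MochizukiEtTh2009`). PROOF-ONLY companion (no `def`; seat abc-iut-L2-t2, DAG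
node `EtTh:Cor2.16`) of `ThetaSystems.lean` / `Discharge/Sec2NondiscretenessProofs.lean`.

`ThetaEnvTower.cor216_of` (same seat) discharged the named fact `Cor216` under a shift hypothesis
quantified over ALL `x ∈ Π^tp_X` whose image in `Gal(Y/X) ≅ ℤ` is divisible by the level `M`. That
binder is STRONGER than what the printed construction uses and than what the geometric model offers:
an element of `Π^tp_Y ∖ Π^tp_Ÿ` (image `0`, divisible by every `M`) acts on the étale theta class
through `Gal(Ÿ/Y)`, i.e. by `Θ̈(−Ü) = −Θ̈(Ü)` (Prop 1.4 (ii)), changing the class by the Kummer class of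
`−1`, which is not a coboundary mod `M` unless `−1 ∈ (K^×)^M`. The construction of Cor 2.16 only ever
conjugates by POWERS `x₁^a`, `M ∣ a`, of ONE generator `x₁` (print: "the action of `j_{M'} − j_M ∈ M·ℤ`",
Prop 2.15 (iii); "an `N·(l·ℤ)`-conjugate of `s^Θ`", Prop 2.14 (iii)) — for which the sign characters die
(`a·κ(−1) ≡ 0`). This file re-proves the discharge from exactly that:
`ThetaEnvTower.cor216_of_generator_aux` (a given generator `x₁` with `aug x₁ = 1` whose `M`-divisible
powers shift every mod-`M` theta cocycle by a coboundary), `ThetaEnvTower.cor216_of_generator` (every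
generator does; `Π^tp_Ÿ ↠ G_K` supplies one with `aug x₁ = 1`), and the model-tower form
`DoubleUnderline.cor216_of_model_generator`. HONEST FRAMING: conditional discharges; no side is taken on
[IUTchIII] Cor 3.12; typed ≠ discharged elsewhere.
-/

noncomputable section

namespace Literature.AnabelianGeometry.EtaleTheta

open Literature.AnabelianGeometry.SemiGraphs

universe u

namespace ThetaEnvTower

variable {E : Set ℕ+} (T : ThetaEnvTower.{u} E)

/-- **Corollary 2.16 from the symmetries attached to ONE generator**: if `x₁ ∈ Π^tp_X` generates
`Gal(Y/X) ≅ ℤ`, has trivial image in `G_K`, and conjugation by `x₁^a`, `M ∣ a`, carries every mod-`M`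
theta cocycle to itself times a coboundary (the bi-theta case of Prop 2.14 (iii) for the
`M·(l·ℤ)`-conjugates `x₁^a`), then the named fact `Cor216` holds, with the projective system
`γ_{M',M} := conj(x₁^{k_{M'}−k_M}) ∘ β_{M',M}`, `k_M ≡ j_M (mod M)`, `k_1 = 0`.
[cite: MochizukiEtTh2009, Cor 2.16 p.53] -/
theorem cor216_of_generator_aux (x₁ : T.PiX)
    (hx₁ : T.galYX (QuotientGroup.mk x₁) = Multiplicative.ofAdd (1 : ℤ)) (haug₁ : T.aug x₁ = 1)
    (hshift₁ : ∀ (M : E) (η : T.PiYdd → T.mu M), η ∈ T.thetaCocycles M → ∀ a : ℤ,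
      ((M : ℕ+) : ℤ) ∣ a → ∃ c : T.mu M, T.conjCocycle M (x₁ ^ a) η =
        η * CycEnvelope.coboundary (T.aug.comp T.PiYdd.subtype) (T.chi M) c) :
    T.Cor216 := by
  haveI : T.PiY.Normal := T.PiY_normal
  intro η hη _ j hj
  have hgal : ∀ a : ℤ, T.galYX (QuotientGroup.mk (x₁ ^ a)) = Multiplicative.ofAdd a := fun a => by
    rw [QuotientGroup.mk_zpow, map_zpow, hx₁, ← ofAdd_zsmul, smul_eq_mul, mul_one]
  have haugx : ∀ a : ℤ, T.aug (x₁ ^ a) = 1 := fun a => by rw [map_zpow, haug₁, one_zpow]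
  -- integer lifts `k_M ≡ j_M (mod M)` with `k_1 = 0`
  obtain ⟨k, hkj, hk1⟩ : ∃ k : E → ℤ,
      (∀ M : E, ((k M : ℤ) : ZMod (M : ℕ+)) = j M) ∧ k ⟨1, T.one_mem⟩ = 0 := by
    classical
    have hex : ∀ M : E, ∃ z : ℤ, (z : ZMod (M : ℕ+)) = j M := fun M => ZMod.intCast_surjective (j M)
    choose k₀ hk₀ using hex
    refine ⟨fun M => if ((M : ℕ+) : ℕ) = 1 then 0 else k₀ M, fun M => ?_, by simp⟩
    by_cases hM : ((M : ℕ+) : ℕ) = 1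
    · haveI := (ZMod.subsingleton_iff (n := ((M : ℕ+) : ℕ))).mpr hM
      exact Subsingleton.elim _ _
    · show ((if ((M : ℕ+) : ℕ) = 1 then (0 : ℤ) else k₀ M : ℤ) : ZMod (M : ℕ+)) = j M
      rw [if_neg hM]
      exact hk₀ M
  -- `M ∣ k_{M'} − k_M` for `M ∣ M'` (compatibility of `j`)
  have hdvd : ∀ (M M' : E), (M : ℕ+) ∣ M' → ((M : ℕ+) : ℤ) ∣ k M' - k M := by
    intro M M' h
    have h1 := hj M M' h
    rw [← hkj M', ← hkj M, map_intCast] at h1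
    exact (ZMod.intCast_eq_intCast_iff_dvd_sub (k M) (k M') (M : ℕ+)).mp h1.symm
  -- the projective system `γ`
  refine ⟨fun M M' h => ((T.level M).conjX (x₁ ^ (k M' - k M))).toMonoidHom.comp (T.redEnv M M' h),
    fun M M' h => ?_, fun M h x => ?_, fun M M' M'' h h' x => ?_, ?_⟩
  · -- (a): `conj(x₁^{k_{M'}−k_M})` is an automorphism of `B_M` since `M ∣ k_{M'} − k_M`
    obtain ⟨c, hc⟩ := hshift₁ M (η M) (hη M) (k M' - k M) (hdvd M M' h)
    obtain ⟨α, hα⟩ := T.exists_biIso_conjX M (hη M) (x₁ ^ (k M' - k M)) c hc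
    obtain ⟨α', hα'⟩ := T.exists_biIso_refl M' (hη M')
    exact ⟨α, α', fun x => by rw [hα', hα]; rfl⟩
  · -- `γ_{M,M} = id`
    change (T.level M).conjX (x₁ ^ (k M - k M)) (T.redEnv M M h x) = x
    rw [sub_self, zpow_zero, T.conjX_one M, MulAut.one_apply, T.redEnv_self]
  · -- `γ_{M'',M} = γ_{M',M} ∘ γ_{M'',M'}`
    change (T.level M).conjX (x₁ ^ (k M'' - k M)) (T.redEnv M M'' (h.trans h') x) =
      (T.level M).conjX (x₁ ^ (k M' - k M)) (T.redEnv M M' h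
        ((T.level M').conjX (x₁ ^ (k M'' - k M')) (T.redEnv M' M'' h' x)))
    rw [T.reduces_conjX h (x₁ ^ (k M'' - k M')) (T.redEnv M' M'' h' x), ← MulAut.mul_apply,
      ← ThetaEnvData.conjX_mul, ← zpow_add, ← T.redEnv_comp M M' M'' h h',
      show k M' - k M + (k M'' - k M') = k M'' - k M by ring]
  · -- (b): `x_M := x₁^{k_M}`, `ψ := conj(x_M)|_{Π^tp_Ÿ}`, `c := 1`
    haveI : T.PiYdd.Normal := T.PiYdd_normal
    haveI : Subsingleton (T.mu ⟨1, T.one_mem⟩) :=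
      Fintype.card_le_one_iff_subsingleton.mp (by rw [T.card_mu]; exact le_rfl)
    refine ⟨k, fun M => x₁ ^ k M, hkj, fun M => hgal (k M), fun M h1 => ?_⟩
    refine ⟨MulAut.conjNormal (x₁ ^ k M), 1, fun g => ?_, fun g => ?_⟩
    · change (T.level ⟨1, T.one_mem⟩).conjX (x₁ ^ (k M - k ⟨1, T.one_mem⟩))
          (T.redEnv ⟨1, T.one_mem⟩ M h1 ((T.level M).sTheta (hη M) g)) = _
      rw [hk1, sub_zero]
      ext
      · exact Subsingleton.elim _ _
      · change x₁ ^ k M * (g : T.PiX) * (x₁ ^ k M)⁻¹ =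
          ((MulAut.conjNormal (x₁ ^ k M) g : T.PiYdd) : T.PiX)
        rw [MulAut.conjNormal_apply]
    · have hψ : (MulAut.conjNormal (x₁ ^ k M)).symm g = ⟨(x₁ ^ k M)⁻¹ * g * x₁ ^ k M, by
          simpa [mul_assoc] using T.PiYdd_normal.conj_mem _ g.2 (x₁ ^ k M)⁻¹⟩ :=
        Subtype.ext (MulAut.conjNormal_symm_apply _ _)
      rw [hψ]
      simp only [ThetaEnvTower.conjCocycle, haugx, map_one, MulAut.one_apply, CycEnvelope.coboundary,
        inv_one, mul_one]

/-- **Corollary 2.16 — DISCHARGED modulo `Π^tp_Ÿ ↠ G_K` and the bi-theta symmetry clause of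
Prop 2.14 (iii) for the `M·(l·ℤ)`-conjugates `x^a` (`x` any generator of `Gal(Y/X)`, `M ∣ a`)**:
sharpens `cor216_of` (whose shift binder ranged over all of `Π^tp_X`).
[cite: MochizukiEtTh2009, Cor 2.16 p.53] -/
theorem cor216_of_generator (haug : Function.Surjective (T.aug.comp T.PiYdd.subtype))
    (hshift : ∀ x : T.PiX, T.galYX (QuotientGroup.mk x) = Multiplicative.ofAdd (1 : ℤ) →
      ∀ (M : E) (η : T.PiYdd → T.mu M), η ∈ T.thetaCocycles M → ∀ a : ℤ,
      ((M : ℕ+) : ℤ) ∣ a → ∃ c : T.mu M, T.conjCocycle M (x ^ a) η =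
        η * CycEnvelope.coboundary (T.aug.comp T.PiYdd.subtype) (T.chi M) c) :
    T.Cor216 := by
  haveI : T.PiY.Normal := T.PiY_normal
  -- a generator `x₁` of `Gal(Y/X) ≅ ℤ` with trivial image in `G_K`
  obtain ⟨x₁, hx₁, haug₁⟩ : ∃ x₁ : T.PiX,
      T.galYX (QuotientGroup.mk x₁) = Multiplicative.ofAdd (1 : ℤ) ∧ T.aug x₁ = 1 := by
    obtain ⟨q, hq⟩ := QuotientGroup.mk_surjective (T.galYX.symm (Multiplicative.ofAdd (1 : ℤ)))
    obtain ⟨y, hy⟩ := haug (T.aug q)⁻¹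
    refine ⟨q * (y : T.PiX), ?_, ?_⟩
    · rw [QuotientGroup.mk_mul, (QuotientGroup.eq_one_iff (y : T.PiX)).mpr (T.PiYdd_le y.2), mul_one,
        hq, MulEquiv.apply_symm_apply]
    · rw [map_mul]
      change T.aug q * (T.aug.comp T.PiYdd.subtype) y = 1
      rw [hy, mul_inv_cancel]
  exact T.cor216_of_generator_aux x₁ hx₁ haug₁ (hshift x₁ hx₁)

end ThetaEnvTower

/-! ## The model tower of `X̲̲` -/

namespace ThetaSetting.EtaleThetaData.DoubleUnderline

variable {p : ℕ} [Fact p.Prime] {D : ThetaSetting p} {E : D.EtaleThetaData} {l : ℕ}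
  (C : E.DoubleUnderline l) {Es : Set ℕ+} (τ : D.CyclotomeTower l Es)

/-- **Corollary 2.16 for the model tower of `X̲̲`** — conditional only on the bi-theta symmetry clause of
Prop 2.14 (iii) for the powers `x^a`, `M ∣ a`, of the generators `x` of `Gal(Y/X̲̲)` (`Π^tp_Ÿ̲̲ ↠ G_K`
holds for the model: `DoubleUnderline.map_aug_Ydduu`). [cite: MochizukiEtTh2009, Cor 2.16 p.53] -/
theorem cor216_of_model_generator (hC : D.Compat) (hS : D.Sec2Hyps)
    (hshift : ∀ x : (C.thetaEnvTower τ hC hS).PiX,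
      (C.thetaEnvTower τ hC hS).galYX (QuotientGroup.mk x) = Multiplicative.ofAdd (1 : ℤ) →
      ∀ (M : Es) (η : (C.thetaEnvTower τ hC hS).PiYdd → (C.thetaEnvTower τ hC hS).mu M),
      η ∈ (C.thetaEnvTower τ hC hS).thetaCocycles M → ∀ a : ℤ, ((M : ℕ+) : ℤ) ∣ a →
      ∃ c : (C.thetaEnvTower τ hC hS).mu M, (C.thetaEnvTower τ hC hS).conjCocycle M (x ^ a) η =
        η * CycEnvelope.coboundary ((C.thetaEnvTower τ hC hS).aug.comp
          (C.thetaEnvTower τ hC hS).PiYdd.subtype) ((C.thetaEnvTower τ hC hS).chi M) c) :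
    (C.thetaEnvTower τ hC hS).Cor216 := by
  refine (C.thetaEnvTower τ hC hS).cor216_of_generator (fun γ => ?_) hshift
  have h : (γ : GQp p) ∈ (D.GtpYdd ⊓ C.Huu).map D.aug.toMonoidHom := by
    rw [C.map_aug_Ydduu]; exact γ.2
  obtain ⟨k, hk, hkγ⟩ := h
  exact ⟨⟨⟨k, (Subgroup.mem_inf.1 hk).2⟩, (Subgroup.mem_inf.1 hk).1⟩, Subtype.ext hkγ⟩

end ThetaSetting.EtaleThetaData.DoubleUnderline

end Literature.AnabelianGeometry.EtaleTheta

end
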